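import Summits.RiemannHypothesis.RiemannHypothesis.Theorems.HandoffWallMotion
import Summits.RiemannHypothesis.RiemannHypothesis.Theorems.HandoffWallSequence
import Summits.RiemannHypothesis.RiemannHypothesis.Theorems.HandoffUpperClauses
import Summits.RiemannHypothesis.RiemannHypothesis.Theorems.HandoffLadderTheoremRungs
import Summits.RiemannHypothesis.RiemannHypothesis.Theorems.SemilocalNegCertTwoThree
import Summits.RiemannHypothesis.RiemannHypothesis.Theorems.WeilParityEvenWinsBeyondArchFrontierCell7OfBlocks
import HarnessLib

/-!
# HANDOFF — «5 MOVES THE WALL» from the `83/100` rung: `a*({2,3}) < a*({2,3,5})` given the two sector certificates at `83/100` (cell rh-explicit, TRACK «HANDOFF», seat theory-2 gen6)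

HONEST FRAMING. Nothing here bears on the truth of RH. theory-1's `HandoffWallMotion.two_primes_move_the_wall` proves, RH-free, that the
primes `2` and `3` each strictly raise the semi-local wall (`a*(∅) < a*({2}) < a*({2,3})`), via the rungs `H(2)`, `H(3)` and the kernel upper
clauses. PNT-T3 §T3.5 lists «5 moves the wall as a THEOREM: any kernel rung `WPO(t)` with `t > 163/200`» among what remains RH-free per prime.
This file does the bookkeeping: the comparison needs NO `H(5)` (which would be `WPO((log 7)/2)`), only a full-form rung STRICTLY ABOVE the
kernel upper end `a*({2,3}) ≤ 163/200` (`SemilocalNegCertTwoThree.weilSemilocalThreshold_twoThree_le_0815`, cc-s2-4): by locality a rung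
`WPO(a)` with `(log 5)/2 ≤ a ≤ (log 6)/2` is a positivity statement for the `{2,3,5}`-form on `C(a)`, hence `a ≤ a*({2,3,5})`.
* `weilSemilocalPositivityOn_seven_of_weilPositivityOn` — locality: `WPO(a) → WeilSemilocalPositivityOn (primesBelow 7) a` for `a ≤ (log 6)/2`;
* `wall_five_lt_wall_seven_of_weilPositivityOn` — `WPO(a)` with `163/200 < a ≤ (log 6)/2` ⟹ `a*(S_5) < a*(S_7)` («5 moves the wall»);
* `wall_five_lt_wall_seven_of_sector_energies_83` — the same from the TWO SECTOR CERTIFICATES `0 ≤ ε_ev(83/100)`, `0 ≤ ε_od(83/100)`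
  (exactly the shape the GroundBarta programme's `c = 83/100` cell is assembling in the kernel; `weilPositivityOn_83_of_blocks`), and
  `three_primes_move_the_wall_of_sector_energies_83` (`a*(∅) < a*({2}) < a*({2,3}) < a*({2,3,5})`); consequences in the track's dictionary:
  `weilPositivityOn_log_five_half_of_…` is NOT needed (the rung at `(log 5)/2` is already a theorem); what the `83/100` blocks add is the STRICT
  rise at `5` and the lower bound `83/100 ≤ a*({2,3,5})` (`wall_seven_ge_83_of_sector_energies`), i.e. the `{2,3,5}`-form stays positive `0.015 = 83/100 − 163/200`
  beyond the `{2,3}`-wall — an RH-free instance of theory-1's `weilPositivityOn_of_wall_ne` direction read forwards.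
When the two blocks land as theorems (GroundBarta W-M2 chain), `three_primes_move_the_wall` becomes unconditional by `example`.
References: H. Yoshida, Adv. Stud. Pure Math. 21 (1992) Prop. 6 p. 320 (`Yoshida1992HermitianForms`: thresholds); A. Connes, C. Consani,
Enseign. Math. 69 (2023) §2.1.2 (`ConnesConsani2023`: only the primes below `λ²` enter); this track: HANDOFF-STATEMENT §B.5/§J.16, PNT-T3 §T3.5.
-/

set_option linter.dupNamespace false  -- the mandated namespace repeats `RiemannHypothesis`

noncomputable section

open Set Literature.NumberTheory.LFunctions
open Summit.RiemannHypothesis.RiemannHypothesis.Theorems.MotivicDoor.SemilocalThreshold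
open Summit.RiemannHypothesis.RiemannHypothesis.Theorems.HandoffDecomposition
open Summit.RiemannHypothesis.RiemannHypothesis.Theorems.EvenWinsBeyondArch (weilPositivityOn_83_of_blocks)

namespace Summit.RiemannHypothesis.RiemannHypothesis.Theorems.HandoffWallMotionFive

/-- **Locality**: a full-form rung `WPO(a)` with `a ≤ (log 6)/2` is positivity of the `{p < 7}`-form on `C(a)` (every prime power
`n ≤ 5` has its prime below `7`; only those are visible below `e^{2a} ≤ 6`). [cite: ConnesConsani2023, §2.1.2 (only the primes p < λ² enter QW_λ)] -/
theorem weilSemilocalPositivityOn_seven_of_weilPositivityOn {a : ℝ} (ha : a ≤ Real.log 6 / 2) (hW : WeilPositivityOn a) :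
    WeilSemilocalPositivityOn (Nat.primesBelow 7) a := by
  intro g hg hsupp
  have h6 : Real.log (((5 : ℕ) : ℝ) + 1) / 2 = Real.log 6 / 2 := by norm_num
  have hsupp' : tsupport g ⊆ Icc (-(Real.log (((5 : ℕ) : ℝ) + 1) / 2)) (Real.log (((5 : ℕ) : ℝ) + 1) / 2) := by
    rw [h6]; exact hsupp.trans (Icc_subset_Icc (by linarith) ha)
  rw [weilSemilocalQuadratic_eq_weilQuadratic_of_forall hg (primeFactors_subset_primesBelow_of_lt (by norm_num : 5 < 7)) hsupp']
  exact hW g hg hsupp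

/-- Hence such a rung bounds the wall of `S_7 = {2,3,5}` from below: `a ≤ a*({p < 7})`. [cite: Yoshida1992HermitianForms, Prop. 6 (p. 320), primes restricted to S] -/
theorem le_wall_seven_of_weilPositivityOn {a : ℝ} (ha : a ≤ Real.log 6 / 2) (hW : WeilPositivityOn a) :
    a ≤ weilSemilocalThreshold (Nat.primesBelow 7) :=
  le_weilSemilocalThreshold (weilSemilocalPositivityOn_seven_of_weilPositivityOn ha hW)

/-- `83/100 < (log 6)/2` (`log 6 = log 2 + log 3 > 0.6931 + 0.98`, and `e^{0.98} = (e^{0.1225})⁸ ≤ (1/(1 − 0.1225))⁸ < 3`). [folklore] -/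
theorem lt_log_six_half_83 : (83 / 100 : ℝ) < Real.log 6 / 2 := by
  have h : Real.log 6 = Real.log 2 + Real.log 3 := by
    rw [show (6 : ℝ) = 2 * 3 by norm_num, Real.log_mul (by norm_num) (by norm_num)]
  have h2 := Real.log_two_gt_d9
  have h3 : (0.98 : ℝ) < Real.log 3 := by
    rw [Real.lt_log_iff_exp_lt (by norm_num)]
    have hq : Real.exp (0.1225 : ℝ) ≤ 1 / (1 - 0.1225) := by
      have h0 : (0 : ℝ) < 1 - 0.1225 := by norm_num
      rw [le_div_iff₀ h0]
      have h1 := Real.add_one_le_exp (-(0.1225 : ℝ))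
      have e : Real.exp (0.1225 : ℝ) * Real.exp (-(0.1225 : ℝ)) = 1 := by rw [← Real.exp_add]; norm_num
      nlinarith [Real.exp_pos (0.1225 : ℝ), Real.exp_pos (-(0.1225 : ℝ))]
    have h4 : Real.exp (0.98 : ℝ) = Real.exp 0.1225 ^ 8 := by
      rw [← Real.exp_nat_mul]; norm_num
    rw [h4]
    calc Real.exp 0.1225 ^ 8 ≤ (1 / (1 - 0.1225)) ^ 8 := pow_le_pow_left₀ (Real.exp_pos _).le hq 8
      _ < 3 := by norm_num
  linarith

/-- `163/200 < (log 6)/2`. [folklore] -/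
theorem lt_log_six_half : (163 / 200 : ℝ) < Real.log 6 / 2 := lt_trans (by norm_num) lt_log_six_half_83

/-- **5 MOVES THE WALL, from a rung.** A full-form rung `WPO(a)` with `163/200 < a ≤ (log 6)/2` gives `a*({p < 5}) < a*({p < 7})`:
`a*({2,3}) ≤ 163/200 < a ≤ a*({2,3,5})`. [this track: PNT-T3 §T3.5; cite: Yoshida1992HermitianForms, Prop. 6 (p. 320)] -/
theorem wall_five_lt_wall_seven_of_weilPositivityOn {a : ℝ} (h815 : (163 / 200 : ℝ) < a) (ha : a ≤ Real.log 6 / 2)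
    (hW : WeilPositivityOn a) :
    weilSemilocalThreshold (Nat.primesBelow 5) < weilSemilocalThreshold (Nat.primesBelow 7) := by
  have hup : weilSemilocalThreshold (Nat.primesBelow 5) ≤ ((163 / 200 : ℚ) : ℝ) := by
    rw [HandoffLadderTheoremRungs.primesBelow_five]; exact SemilocalPolyWitness.weilSemilocalThreshold_twoThree_le_0815
  have hq : (((163 / 200 : ℚ) : ℝ)) = (163 / 200 : ℝ) := by push_cast; ring
  rw [hq] at hup
  exact lt_of_le_of_lt hup (h815.trans_le (le_wall_seven_of_weilPositivityOn ha hW))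

/-- **The `{2,3,5}`-wall is at least `83/100`, from the two sector certificates at `83/100`** (`0 ≤ ε_ev(83/100)`, `0 ≤ ε_od(83/100)`,
the GroundBarta `c = 83/100` cell's targets): `83/100 ≤ a*({p < 7})`, i.e. the `{2,3,5}`-form stays positive `≥ 0.015` beyond the kernel
upper end `163/200` of the `{2,3}`-wall. [cite: Yoshida1992HermitianForms, Prop. 6 (p. 320); this track] -/
theorem wall_seven_ge_83_of_sector_energies (hE : 0 ≤ weilEvenGroundEnergy (83 / 100)) (hO : 0 ≤ weilOddGroundEnergy (83 / 100)) :
    (83 / 100 : ℝ) ≤ weilSemilocalThreshold (Nat.primesBelow 7) :=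
  le_wall_seven_of_weilPositivityOn lt_log_six_half_83.le (weilPositivityOn_83_of_blocks hE hO)

/-- **5 MOVES THE WALL, from the two sector certificates at `83/100`.** [this track: PNT-T3 §T3.5] -/
theorem wall_five_lt_wall_seven_of_sector_energies_83 (hE : 0 ≤ weilEvenGroundEnergy (83 / 100))
    (hO : 0 ≤ weilOddGroundEnergy (83 / 100)) :
    weilSemilocalThreshold (Nat.primesBelow 5) < weilSemilocalThreshold (Nat.primesBelow 7) :=
  wall_five_lt_wall_seven_of_weilPositivityOn (by norm_num) lt_log_six_half_83.le (weilPositivityOn_83_of_blocks hE hO)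

/-- **THREE primes move the wall** (given the `83/100` blocks): `a*(∅) < a*({2}) < a*({2,3}) < a*({2,3,5})` — the first two steps are
theory-1's unconditional `two_primes_move_the_wall`. [this track: HANDOFF-STATEMENT §B.5/§J.16, PNT-T3 §T3.5] -/
theorem three_primes_move_the_wall_of_sector_energies_83 (hE : 0 ≤ weilEvenGroundEnergy (83 / 100))
    (hO : 0 ≤ weilOddGroundEnergy (83 / 100)) :
    weilSemilocalThreshold (Nat.primesBelow 2) < weilSemilocalThreshold (Nat.primesBelow 3) ∧
      weilSemilocalThreshold (Nat.primesBelow 3) < weilSemilocalThreshold (Nat.primesBelow 5) ∧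
        weilSemilocalThreshold (Nat.primesBelow 5) < weilSemilocalThreshold (Nat.primesBelow 7) :=
  ⟨wall_two_lt_wall_three, wall_three_lt_wall_five, wall_five_lt_wall_seven_of_sector_energies_83 hE hO⟩

end Summit.RiemannHypothesis.RiemannHypothesis.Theorems.HandoffWallMotionFive

end
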